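import Summits.KontsevichZagierPeriods.KontsevichZagierPeriods.Theorems.SymplecticScissorsRealOnePeriodRelationsStubEllRealise
import Summits.KontsevichZagierPeriods.KontsevichZagierPeriods.Theorems.SymplecticScissorsRealOnePeriodRelationsStubEllTail
import Summits.KontsevichZagierPeriods.KontsevichZagierPeriods.Theorems.MzvKernelInKZ.Negative.PiLine
import Literature.NumberTheory.Transcendental.EllIterRep

/-!
# `RealOnePeriodRelations` (stmt-KontsevichZagierPeriods-10042), line `nash-retraction-thin-strip`,
# the loop layer: stub `stub_ovalRealise`

RULE 2 ALONG THE TWO HALVES OF THE OVAL.  In the loop layer a complete elliptic integral over the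
real oval, `r = [∫_{(e₁,e₂)} g]`, is realised by the closed oval loop whose abscissa is
`x(t) = e₁ + 16(e₂ − e₁)t²(1 − t)²`: `x` increases strictly from `e₁` to `e₂` on `[0, ½]` and
decreases strictly back to `e₁` on `[½, 1]`, with `x′(t) = (e₂ − e₁)·32t(1 − t)(1 − 2t)`.  The
realisation `R` lives on `(0,1)` and has integrand `½ g(x(t)) x′(t)` on `(0, ½)` and
`½ g(x(t)) (−x′(t))` on `(½, 1)`.  This file proves `[r] − [R] ∈ M₁`:

* rule 1a: split `R` at `t = ½` into its restrictions `R₁`, `R₂` to `(0, ½)`, `(½, 1)` (the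
  remainder is the null slice `{t = ½}`, `MzvKernelInKZ.Negative.volume_pt1`),
  `HomotopyInvariance.of_sub_sub_mem_of_cover`;
* rule 2: push each half forward along the chart `x(·)` (`helper_cells_1`): the chart is a
  polynomial with the algebraic coefficients `e₁`, `e₂ − e₁`, hence `ℚ`-semialgebraic together with
  its derivative, which does not vanish on the open halves; it is injective on each half and maps
  each half onto `(e₁, e₂)` (strict monotonicity on `[0, ½]`, the symmetry `x(1 − t) = x(t)`, and
  the intermediate value theorem); both push-forwards have the domain of `r` and the integrand
  `½ g` there (`|x′|` cancels);
* rule 1b: `g = ½ g + ½ g` on the domain of `r` (`HomotopyInvariance.integrandAddRel_subset`).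

References: M. Kontsevich, D. Zagier, *Periods* (2001), §1.2 rules (1), (2); J. Bochnak, M. Coste,
M.-F. Roy, *Real Algebraic Geometry* (1998), §2.2.
-/

noncomputable section

open Set MeasureTheory Filter Topology
open Literature.NumberTheory.Transcendental Literature.ModelTheory.ExponentialFields
open Summit.KontsevichZagierPeriods.SymplecticScissors.RealOnePeriodRelationsNegative (M₁ H₁)

namespace Summit.KontsevichZagierPeriods.SymplecticScissors.RealOnePeriodRelations.LoopLayer

namespace OvalRealise

/-! ## The oval chart `x(t) = e₁ + 16(e₂ − e₁)t²(1 − t)²` -/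

/-- The oval chart `x(t) = e₁ + (e₂ − e₁)·16t²(1 − t)²` has derivative `(e₂ − e₁)·32t(1 − t)(1 − 2t)`.
[folklore] -/
theorem hasDerivAt_chart (e₁ e₂ t : ℝ) :
    HasDerivAt (fun t : ℝ => e₁ + (e₂ - e₁) * (16 * t ^ 2 * (1 - t) ^ 2))
      ((e₂ - e₁) * (32 * t * (1 - t) * (1 - 2 * t))) t := by
  have h2 : HasDerivAt (fun x : ℝ => x ^ 2) (2 * t) t := by simpa using hasDerivAt_pow 2 t
  have h3 : HasDerivAt (fun x : ℝ => x ^ 3) (3 * t ^ 2) t := by simpa using hasDerivAt_pow 3 t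
  have h4 : HasDerivAt (fun x : ℝ => x ^ 4) (4 * t ^ 3) t := by simpa using hasDerivAt_pow 4 t
  have h := ((((h2.const_mul 16).fun_sub (h3.const_mul 32)).fun_add (h4.const_mul 16)).const_mul
    (e₂ - e₁)).const_add e₁
  have hfun : (fun t : ℝ => e₁ + (e₂ - e₁) * (16 * t ^ 2 * (1 - t) ^ 2)) =
      fun t => e₁ + (e₂ - e₁) * (16 * t ^ 2 - 32 * t ^ 3 + 16 * t ^ 4) := by
    funext t
    ring
  rw [hfun]
  exact h.congr_deriv (by ring)

/-- The derivative of the oval chart is positive on `(0, ½)` when `e₁ < e₂`. [folklore] -/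
theorem chart_deriv_pos {e₁ e₂ : ℝ} (h12 : e₁ < e₂) {t : ℝ} (ht : t ∈ Ioo (0 : ℝ) (1 / 2)) :
    0 < (e₂ - e₁) * (32 * t * (1 - t) * (1 - 2 * t)) :=
  mul_pos (sub_pos.mpr h12) (mul_pos (mul_pos (mul_pos (by norm_num) ht.1) (by linarith [ht.2]))
    (by linarith [ht.2]))

/-- The derivative of the oval chart is negative on `(½, 1)` when `e₁ < e₂`. [folklore] -/
theorem chart_deriv_neg {e₁ e₂ : ℝ} (h12 : e₁ < e₂) {t : ℝ} (ht : t ∈ Ioo (1 / 2 : ℝ) 1) :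
    (e₂ - e₁) * (32 * t * (1 - t) * (1 - 2 * t)) < 0 :=
  mul_neg_of_pos_of_neg (sub_pos.mpr h12) (mul_neg_of_pos_of_neg
    (mul_pos (mul_pos (by norm_num) (by linarith [ht.1])) (by linarith [ht.2])) (by linarith [ht.1]))

/-- The oval chart is strictly increasing on `[0, ½]` when `e₁ < e₂`. [folklore] -/
theorem strictMonoOn_chart {e₁ e₂ : ℝ} (h12 : e₁ < e₂) :
    StrictMonoOn (fun t : ℝ => e₁ + (e₂ - e₁) * (16 * t ^ 2 * (1 - t) ^ 2)) (Icc 0 (1 / 2)) := by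
  refine strictMonoOn_of_deriv_pos (convex_Icc 0 (1 / 2)) (by fun_prop) fun x hx => ?_
  rw [interior_Icc] at hx
  rw [(hasDerivAt_chart e₁ e₂ x).deriv]
  exact chart_deriv_pos h12 hx

/-- The value of the oval chart at `t = 0` is `e₁`. [folklore] -/
theorem chart_zero (e₁ e₂ : ℝ) : e₁ + (e₂ - e₁) * (16 * (0 : ℝ) ^ 2 * (1 - 0) ^ 2) = e₁ := by ring

/-- The value of the oval chart at `t = ½` is `e₂`. [folklore] -/
theorem chart_half (e₁ e₂ : ℝ) : e₁ + (e₂ - e₁) * (16 * (1 / 2 : ℝ) ^ 2 * (1 - 1 / 2) ^ 2) = e₂ := by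
  ring

/-- The oval chart maps `(0, ½)` into `(e₁, e₂)` when `e₁ < e₂`. [folklore] -/
theorem chart_mem_Ioo {e₁ e₂ : ℝ} (h12 : e₁ < e₂) {t : ℝ} (ht : t ∈ Ioo (0 : ℝ) (1 / 2)) :
    e₁ + (e₂ - e₁) * (16 * t ^ 2 * (1 - t) ^ 2) ∈ Ioo e₁ e₂ := by
  have hmono := strictMonoOn_chart h12
  have h0 : e₁ + (e₂ - e₁) * (16 * (0 : ℝ) ^ 2 * (1 - 0) ^ 2) <
      e₁ + (e₂ - e₁) * (16 * t ^ 2 * (1 - t) ^ 2) :=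
    hmono (left_mem_Icc.2 (by norm_num)) (Ioo_subset_Icc_self ht) ht.1
  have h1 : e₁ + (e₂ - e₁) * (16 * t ^ 2 * (1 - t) ^ 2) <
      e₁ + (e₂ - e₁) * (16 * (1 / 2 : ℝ) ^ 2 * (1 - 1 / 2) ^ 2) :=
    hmono (Ioo_subset_Icc_self ht) (right_mem_Icc.2 (by norm_num)) ht.2
  rw [chart_zero] at h0
  rw [chart_half] at h1
  exact ⟨h0, h1⟩

/-- The oval chart maps `(0, ½)` onto `(e₁, e₂)` (intermediate value theorem). [folklore] -/
theorem exists_chart_eq {e₁ e₂ x : ℝ} (hx : x ∈ Ioo e₁ e₂) :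
    ∃ t ∈ Ioo (0 : ℝ) (1 / 2), e₁ + (e₂ - e₁) * (16 * t ^ 2 * (1 - t) ^ 2) = x := by
  have hcont : Continuous (fun t : ℝ => e₁ + (e₂ - e₁) * (16 * t ^ 2 * (1 - t) ^ 2)) := by fun_prop
  have h := intermediate_value_Ioo (by norm_num : (0 : ℝ) ≤ 1 / 2) hcont.continuousOn
    (f := fun t : ℝ => e₁ + (e₂ - e₁) * (16 * t ^ 2 * (1 - t) ^ 2))
  rw [chart_zero, chart_half] at h
  exact h hx

/-- The oval chart is `ℚ`-semialgebraic on every `ℚ`-semialgebraic `S ⊆ ℝ¹` when `e₁`, `e₂` are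
algebraic (a polynomial with the algebraic coefficients `e₁`, `e₂ − e₁`).
[cite: BochnakCosteRoy1998, §2.2] -/
theorem isSemialgebraicFunOn_chart {e₁ e₂ : ℝ} (he₁ : IsAlgebraic ℚ e₁) (he₂ : IsAlgebraic ℚ e₂)
    {S : Set (Fin 1 → ℝ)} (hS : IsSemialgebraic ℚ S) :
    IsSemialgebraicFunOn ℚ S (fun p => e₁ + (e₂ - e₁) * (16 * p 0 ^ 2 * (1 - p 0) ^ 2)) := by
  have h0 : IsSemialgebraicFunOn ℚ S (fun p : Fin 1 → ℝ => p 0) := isSemialgebraicFunOn_apply hS 0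
  have h1 : IsSemialgebraicFunOn ℚ S (fun _ => (1 : ℝ)) :=
    isSemialgebraicFunOn_const_of_isAlgebraic hS isAlgebraic_one
  have hc16 : IsSemialgebraicFunOn ℚ S (fun _ => (16 : ℝ)) := isSemialgebraicFunOn_const_ofNat hS 16
  have hce : IsSemialgebraicFunOn ℚ S (fun _ => e₁) := isSemialgebraicFunOn_const_of_isAlgebraic hS he₁
  have hcd : IsSemialgebraicFunOn ℚ S (fun _ => e₂ - e₁) :=
    isSemialgebraicFunOn_const_of_isAlgebraic hS (he₂.sub he₁)
  exact hce.fun_add (hcd.fun_mul ((hc16.fun_mul (h0.fun_pow 2)).fun_mul ((h1.fun_sub h0).fun_pow 2)))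

/-- The derivative of the oval chart is `ℚ`-semialgebraic on every `ℚ`-semialgebraic `S ⊆ ℝ¹` when
`e₁`, `e₂` are algebraic. [cite: BochnakCosteRoy1998, §2.2] -/
theorem isSemialgebraicFunOn_chartDeriv {e₁ e₂ : ℝ} (he₁ : IsAlgebraic ℚ e₁)
    (he₂ : IsAlgebraic ℚ e₂) {S : Set (Fin 1 → ℝ)} (hS : IsSemialgebraic ℚ S) :
    IsSemialgebraicFunOn ℚ S (fun p => (e₂ - e₁) * (32 * p 0 * (1 - p 0) * (1 - 2 * p 0))) := by
  have h0 : IsSemialgebraicFunOn ℚ S (fun p : Fin 1 → ℝ => p 0) := isSemialgebraicFunOn_apply hS 0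
  have h1 : IsSemialgebraicFunOn ℚ S (fun _ => (1 : ℝ)) :=
    isSemialgebraicFunOn_const_of_isAlgebraic hS isAlgebraic_one
  have hc2 : IsSemialgebraicFunOn ℚ S (fun _ => (2 : ℝ)) := isSemialgebraicFunOn_const_ofNat hS 2
  have hc32 : IsSemialgebraicFunOn ℚ S (fun _ => (32 : ℝ)) := isSemialgebraicFunOn_const_ofNat hS 32
  have hcd : IsSemialgebraicFunOn ℚ S (fun _ => e₂ - e₁) :=
    isSemialgebraicFunOn_const_of_isAlgebraic hS (he₂.sub he₁)
  exact hcd.fun_mul (((hc32.fun_mul h0).fun_mul (h1.fun_sub h0)).fun_mul (h1.fun_sub (hc2.fun_mul h0)))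

/-! ## One half of the oval: rule 2 along an injective chart onto `(e₁, e₂)` -/

/-- **One half of the oval.**  If `R'` lives on `{z | z 0 ∈ I}`, the chart `φ` is `ℚ`-semialgebraic
on this domain together with its nowhere-zero derivative `φ'`, injective on `I`, maps `I` onto
`(e₁, e₂)`, and `R'(t) = ½ r(φ t) |φ′ t|` on `I` for a representation `r` on `{z | z 0 ∈ (e₁, e₂)}`,
then the push-forward `s` of `R'` along `φ` (`helper_cells_1`, rule 2) has the domain of `r`, the
integrand `½ r` there, and `[R'] − [s] ∈ M₁`. [cite: KontsevichZagier2001, §1.2 rule (2)] -/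
theorem half_pushforward (r R' : KZ.IntegralRep 1) {e₁ e₂ : ℝ} (I : Set ℝ)
    (hr : r.domain = {z | z 0 ∈ Ioo e₁ e₂}) (hR' : ∀ p, p ∈ R'.domain ↔ p 0 ∈ I) (φ φ' : ℝ → ℝ)
    (hφs : IsSemialgebraicFunOn ℚ R'.domain (fun p => φ (p 0)))
    (hφ's : IsSemialgebraicFunOn ℚ R'.domain (fun p => φ' (p 0)))
    (hder : ∀ t ∈ I, HasDerivAt φ (φ' t) t) (hne : ∀ t ∈ I, φ' t ≠ 0) (hinj : InjOn φ I)
    (hmaps : ∀ t ∈ I, φ t ∈ Ioo e₁ e₂) (hsurj : ∀ x ∈ Ioo e₁ e₂, ∃ t ∈ I, φ t = x)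
    (hint : ∀ t ∈ I, R'.integrand (fun _ => t) = 1 / 2 * r.integrand (fun _ => φ t) * |φ' t|) :
    ∃ s : KZ.IntegralRep 1, s.domain = r.domain ∧
      (∀ z ∈ r.domain, s.integrand z = 1 / 2 * r.integrand z) ∧ KZ.of R' - KZ.of s ∈ M₁ := by
  have hinj' : InjOn (fun p : Fin 1 → ℝ => fun _ : Fin 1 => φ (p 0)) R'.domain := by
    intro p hp p' hp' h
    have h0 : φ (p 0) = φ (p' 0) := congrFun h 0
    have : p 0 = p' 0 := hinj ((hR' p).1 hp) ((hR' p').1 hp') h0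
    rw [KZ.eq_const_apply_zero p, KZ.eq_const_apply_zero p', this]
  obtain ⟨s, hsdom, hsi, hrel⟩ := helper_cells_1 R' φ φ' hφs hφ's
    (fun p hp => hder _ ((hR' p).1 hp)) (fun p hp => hne _ ((hR' p).1 hp)) hinj'
  refine ⟨s, ?_, ?_, hrel⟩
  · -- the image of `I` under the chart is `(e₁, e₂)`
    rw [hsdom, hr]
    ext z
    constructor
    · rintro ⟨p, hp, rfl⟩
      exact hmaps _ ((hR' p).1 hp)
    · intro hz
      obtain ⟨t, ht, htz⟩ := hsurj _ hz
      refine ⟨fun _ => t, (hR' _).2 ht, ?_⟩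
      rw [KZ.eq_const_apply_zero z]
      funext
      exact htz
  · -- the integrand of the push-forward is `½ r` (`|φ′|` cancels)
    intro z hz
    have hz' : z 0 ∈ Ioo e₁ e₂ := by
      rw [hr] at hz
      exact hz
    obtain ⟨t, ht, htz⟩ := hsurj _ hz'
    have h := hsi (fun _ => t) ((hR' _).2 ht)
    rw [hint t ht, mul_div_cancel_right₀ _ (abs_ne_zero.mpr (hne t ht))] at h
    rw [KZ.eq_const_apply_zero z, ← htz]
    exact h

end OvalRealise

/-- **Stub `stub_ovalRealise`** — RULE 2 ALONG THE TWO HALVES OF THE OVAL.  A representation `r` on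
`{z | z 0 ∈ (e₁, e₂)}` and a representation `R` on `(0,1)` whose integrand is `½ r(x(t)) x′(t)` on
`(0, ½)` and `½ r(x(t)) (−x′(t))` on `(½, 1)`, `x(t) = e₁ + 16(e₂ − e₁)t²(1 − t)²` (increasing onto
`(e₁, e₂)` on the first half, decreasing on the second), differ by an element of `M₁`: split `R` at
`t = ½` (rule 1a), push each half forward along `x(·)` (`helper_cells_1`), add the two push-forwards
(rule 1b, `½ r + ½ r = r`). [cite: KontsevichZagier2001, §1.2 rules (1), (2)] -/
theorem stub_ovalRealise : ∀ (e₁ e₂ : ℝ), IsAlgebraic ℚ e₁ → IsAlgebraic ℚ e₂ → e₁ < e₂ →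
    ∀ (r R : KZ.IntegralRep 1), r.domain = {z | z 0 ∈ Set.Ioo e₁ e₂} → R.domain = {z | z 0 ∈ Set.Ioo (0 : ℝ) 1} →
    (∀ t ∈ Set.Ioo (0 : ℝ) (1 / 2), R.integrand (fun _ => t) =
      1 / 2 * (r.integrand (fun _ => e₁ + (e₂ - e₁) * (16 * t ^ 2 * (1 - t) ^ 2)) *
        ((e₂ - e₁) * (32 * t * (1 - t) * (1 - 2 * t))))) →
    (∀ t ∈ Set.Ioo (1 / 2 : ℝ) 1, R.integrand (fun _ => t) =
      1 / 2 * (r.integrand (fun _ => e₁ + (e₂ - e₁) * (16 * t ^ 2 * (1 - t) ^ 2)) *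
        -((e₂ - e₁) * (32 * t * (1 - t) * (1 - 2 * t))))) →
    KZ.of r - KZ.of R ∈ M₁ := by
  intro e₁ e₂ he₁ he₂ h12 r R hr hR hR₁ hR₂
  -- the chart and its derivative, as opaque functions with their defining equations
  obtain ⟨φ, hφ⟩ : ∃ φ : ℝ → ℝ, ∀ t, φ t = e₁ + (e₂ - e₁) * (16 * t ^ 2 * (1 - t) ^ 2) :=
    ⟨_, fun _ => rfl⟩
  obtain ⟨φ', hφ'⟩ : ∃ φ' : ℝ → ℝ, ∀ t, φ' t = (e₂ - e₁) * (32 * t * (1 - t) * (1 - 2 * t)) :=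
    ⟨_, fun _ => rfl⟩
  have hφfun : φ = fun t => e₁ + (e₂ - e₁) * (16 * t ^ 2 * (1 - t) ^ 2) := funext hφ
  have hhalf : IsAlgebraic ℚ (1 / 2 : ℝ) := by
    have h : IsAlgebraic ℚ ((2 : ℕ) : ℝ) := isAlgebraic_nat 2
    rw [Nat.cast_ofNat] at h
    exact one_div (2 : ℝ) ▸ h.inv
  -- (1) rule 1a: split `R` at `t = ½`
  have hlt : IsSemialgebraic ℚ {z : Fin 1 → ℝ | z 0 < 1 / 2} :=
    KZ.isSemialgebraic_setOf_apply_lt_const hhalf 0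
  have hgt : IsSemialgebraic ℚ {z : Fin 1 → ℝ | 1 / 2 < z 0} :=
    KZ.isSemialgebraic_setOf_const_lt_apply hhalf 0
  obtain ⟨R₁, hR₁d, hR₁i⟩ : ∃ R₁ : KZ.IntegralRep 1, R₁.domain = R.domain ∩ {z | z 0 < 1 / 2} ∧
      R₁.integrand = R.integrand :=
    ⟨R.restrict _ (R.isSemialgebraic_domain.inter hlt) inter_subset_left, rfl, rfl⟩
  obtain ⟨R₂, hR₂d, hR₂i⟩ : ∃ R₂ : KZ.IntegralRep 1, R₂.domain = R.domain ∩ {z | 1 / 2 < z 0} ∧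
      R₂.integrand = R.integrand :=
    ⟨R.restrict _ (R.isSemialgebraic_domain.inter hgt) inter_subset_left, rfl, rfl⟩
  have hsplit : KZ.of R - KZ.of R₁ - KZ.of R₂ ∈ M₁ := by
    refine HomotopyInvariance.of_sub_sub_mem_of_cover R R₁ R₂ (by rw [hR₁d]; exact inter_subset_left)
      (by rw [hR₂d]; exact inter_subset_left) (fun _ _ => by rw [hR₁i]) (fun _ _ => by rw [hR₂i]) ?_ ?_
    · -- the two halves are disjoint
      rw [hR₁d, hR₂d]
      refine measure_mono_null (fun z hz => ?_) measure_empty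
      have h1 : z 0 < 1 / 2 := hz.1.2
      have h2 : 1 / 2 < z 0 := hz.2.2
      exact (lt_asymm h1 h2).elim
    · -- the remainder is the null slice `{t = ½}`
      rw [hR₁d, hR₂d]
      refine measure_mono_null (fun z hz => ?_) (MzvKernelInKZ.Negative.volume_pt1 (1 / 2))
      obtain ⟨hzR, hzU⟩ := hz
      simp only [mem_union, not_or] at hzU
      have h1 : ¬ z 0 < 1 / 2 := fun h => hzU.1 ⟨hzR, h⟩
      have h2 : ¬ 1 / 2 < z 0 := fun h => hzU.2 ⟨hzR, h⟩
      exact le_antisymm (not_lt.1 h2) (not_lt.1 h1)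
  -- membership in the two halves
  have hmem₁ : ∀ p : Fin 1 → ℝ, p ∈ R₁.domain ↔ p 0 ∈ Ioo (0 : ℝ) (1 / 2) := fun p => by
    rw [hR₁d, hR]
    simp only [mem_inter_iff, mem_setOf_eq, mem_Ioo]
    constructor
    · rintro ⟨⟨h0, _⟩, h2⟩
      exact ⟨h0, h2⟩
    · rintro ⟨h0, h2⟩
      exact ⟨⟨h0, by linarith⟩, h2⟩
  have hmem₂ : ∀ p : Fin 1 → ℝ, p ∈ R₂.domain ↔ p 0 ∈ Ioo (1 / 2 : ℝ) 1 := fun p => by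
    rw [hR₂d, hR]
    simp only [mem_inter_iff, mem_setOf_eq, mem_Ioo]
    constructor
    · rintro ⟨⟨_, h1⟩, h2⟩
      exact ⟨h2, h1⟩
    · rintro ⟨h2, h1⟩
      exact ⟨⟨by linarith, h1⟩, h2⟩
  -- (2) the chart: semialgebraicity, calculus, injectivity and surjectivity on each half
  have hφs : ∀ {S : Set (Fin 1 → ℝ)}, IsSemialgebraic ℚ S →
      IsSemialgebraicFunOn ℚ S (fun p => φ (p 0)) := fun hS =>
    (OvalRealise.isSemialgebraicFunOn_chart he₁ he₂ hS).congr fun p _ => (hφ (p 0)).symm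
  have hφ's : ∀ {S : Set (Fin 1 → ℝ)}, IsSemialgebraic ℚ S →
      IsSemialgebraicFunOn ℚ S (fun p => φ' (p 0)) := fun hS =>
    (OvalRealise.isSemialgebraicFunOn_chartDeriv he₁ he₂ hS).congr fun p _ => (hφ' (p 0)).symm
  have hder : ∀ t : ℝ, HasDerivAt φ (φ' t) t := fun t => by
    rw [hφfun, hφ']
    exact OvalRealise.hasDerivAt_chart e₁ e₂ t
  have hpos : ∀ t ∈ Ioo (0 : ℝ) (1 / 2), 0 < φ' t := fun t ht => by
    rw [hφ']
    exact OvalRealise.chart_deriv_pos h12 ht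
  have hneg : ∀ t ∈ Ioo (1 / 2 : ℝ) 1, φ' t < 0 := fun t ht => by
    rw [hφ']
    exact OvalRealise.chart_deriv_neg h12 ht
  have hmono : StrictMonoOn φ (Icc 0 (1 / 2)) := by
    rw [hφfun]
    exact OvalRealise.strictMonoOn_chart h12
  have hsymm : ∀ t, φ (1 - t) = φ t := fun t => by
    rw [hφ, hφ]
    ring
  have hrefl : ∀ t ∈ Ioo (1 / 2 : ℝ) 1, 1 - t ∈ Ioo (0 : ℝ) (1 / 2) := fun t ht =>
    ⟨by linarith [ht.2], by linarith [ht.1]⟩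
  have hmaps₁ : ∀ t ∈ Ioo (0 : ℝ) (1 / 2), φ t ∈ Ioo e₁ e₂ := fun t ht => by
    rw [hφ]
    exact OvalRealise.chart_mem_Ioo h12 ht
  have hmaps₂ : ∀ t ∈ Ioo (1 / 2 : ℝ) 1, φ t ∈ Ioo e₁ e₂ := fun t ht => by
    rw [← hsymm]
    exact hmaps₁ _ (hrefl t ht)
  have hsurj₁ : ∀ x ∈ Ioo e₁ e₂, ∃ t ∈ Ioo (0 : ℝ) (1 / 2), φ t = x := fun x hx => by
    simp only [hφ]
    exact OvalRealise.exists_chart_eq hx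
  have hsurj₂ : ∀ x ∈ Ioo e₁ e₂, ∃ t ∈ Ioo (1 / 2 : ℝ) 1, φ t = x := fun x hx => by
    obtain ⟨t, ht, htx⟩ := hsurj₁ x hx
    exact ⟨1 - t, ⟨by linarith [ht.2], by linarith [ht.1]⟩, by rw [hsymm]; exact htx⟩
  have hinj₁ : InjOn φ (Ioo (0 : ℝ) (1 / 2)) := hmono.injOn.mono Ioo_subset_Icc_self
  have hinj₂ : InjOn φ (Ioo (1 / 2 : ℝ) 1) := by
    intro t ht t' ht' h
    rw [← hsymm t, ← hsymm t'] at h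
    have := hmono.injOn (Ioo_subset_Icc_self (hrefl t ht)) (Ioo_subset_Icc_self (hrefl t' ht')) h
    linarith
  -- the integrands of the two halves are `½ r(φ t) |φ′ t|`
  have hint₁ : ∀ t ∈ Ioo (0 : ℝ) (1 / 2),
      R₁.integrand (fun _ => t) = 1 / 2 * r.integrand (fun _ => φ t) * |φ' t| := by
    intro t ht
    rw [hR₁i, hR₁ t ht, ← hφ t, ← hφ' t, abs_of_pos (hpos t ht)]
    ring
  have hint₂ : ∀ t ∈ Ioo (1 / 2 : ℝ) 1,
      R₂.integrand (fun _ => t) = 1 / 2 * r.integrand (fun _ => φ t) * |φ' t| := by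
    intro t ht
    rw [hR₂i, hR₂ t ht, ← hφ t, ← hφ' t, abs_of_neg (hneg t ht)]
    ring
  -- rule 2 on each half
  obtain ⟨s₁, hs₁d, hs₁i, hrel₁⟩ := OvalRealise.half_pushforward r R₁ (Ioo 0 (1 / 2)) hr hmem₁ φ φ'
    (hφs R₁.isSemialgebraic_domain) (hφ's R₁.isSemialgebraic_domain) (fun t _ => hder t)
    (fun t ht => (hpos t ht).ne') hinj₁ hmaps₁ hsurj₁ hint₁
  obtain ⟨s₂, hs₂d, hs₂i, hrel₂⟩ := OvalRealise.half_pushforward r R₂ (Ioo (1 / 2) 1) hr hmem₂ φ φ'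
    (hφs R₂.isSemialgebraic_domain) (hφ's R₂.isSemialgebraic_domain) (fun t _ => hder t)
    (fun t ht => (hneg t ht).ne) hinj₂ hmaps₂ hsurj₂ hint₂
  -- (3) rule 1b: `r = ½ r + ½ r` on the domain of `r`
  have hadd : KZ.of r - KZ.of s₁ - KZ.of s₂ ∈ M₁ := by
    refine HomotopyInvariance.integrandAddRel_subset ⟨1, r, s₁, s₂, hs₁d, hs₂d, fun z hz => ?_, rfl⟩
    show r.integrand z = s₁.integrand z + s₂.integrand z
    rw [hs₁i z hz, hs₂i z hz]
    ring
  -- (4) bookkeeping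
  have e : KZ.of r - KZ.of R = (KZ.of r - KZ.of s₁ - KZ.of s₂) - (KZ.of R - KZ.of R₁ - KZ.of R₂) -
      (KZ.of R₁ - KZ.of s₁) - (KZ.of R₂ - KZ.of s₂) := by
    abel
  rw [e]
  exact M₁.sub_mem (M₁.sub_mem (M₁.sub_mem hadd hsplit) hrel₁) hrel₂

end Summit.KontsevichZagierPeriods.SymplecticScissors.RealOnePeriodRelations.LoopLayer

end
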